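import Summits.Ventures.Crystal3D.Theorems.StickyWulffConstantNoReconstructionGainCubicActions
import HarnessLib

/-!
# Sorting the cubic coordinates by a lattice isometry (route-independent form)

HONEST FRAMING. Part of the venture `Summits/Ventures/Crystal3D` (cell `crystal3d-full`), helper
`--supports` the crux `NoReconstructionGain` (stmt-Ventures-19144, route
`route-Ventures-StickyWulffConstant`), line `adhesion` (wulff-p1 g11).  `…NoReconstructionGainChamber`
proves, in two steps, that a lattice isometry of `Λ₀ = fccStacking 1 √(2/3)` makes the three cubic
coordinates `A, B, C` of any vector non-negative and sorted; that module imports the route file.  This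
module restates the COMBINED step with a self-contained proof over `…CubicActions` only (bond mirrors
act on `(A, B, C)` by signed permutations), so that route-independent files (the cap-budget bricks
`…GrainFrame*`) can use the chamber reduction without entering the route's import cone:

* `exists_latticeIsometry_cubic_sorted_nonneg` — for every `x` some lattice isometry `g` has
  `0 ≤ A (g x) ≤ B (g x) ≤ C (g x)`.

WHAT THIS IS NOT: anything about the crux itself; rung F-C1 not moved.
-/

noncomputable section

namespace Summit.Ventures.Crystal3D.Theorems

open Summit.Ventures.Crystal3D
open Literature.MathematicalPhysics.StatisticalMechanics (fccStacking barlowPos constHagg)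
open scoped InnerProductSpace

set_option maxHeartbeats 400000 in
/-- **Chamber step (combined): some lattice isometry sorts the cubic coordinates non-negatively.** -/
theorem exists_latticeIsometry_cubic_sorted_nonneg (A B C : EuclideanSpace ℝ (Fin 3) → ℝ)
    (hA : ∀ x, A x = x 0 + Real.sqrt 3 / 3 * x 1 - Real.sqrt (2 / 3) * x 2)
    (hB : ∀ x, B x = x 0 - Real.sqrt 3 / 3 * x 1 + Real.sqrt (2 / 3) * x 2)
    (hC : ∀ x, C x = 2 * Real.sqrt 3 / 3 * x 1 + Real.sqrt (2 / 3) * x 2)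
    (x : EuclideanSpace ℝ (Fin 3)) :
    ∃ g : EuclideanSpace ℝ (Fin 3) ≃ₗᵢ[ℝ] EuclideanSpace ℝ (Fin 3),
      ((∀ p ∈ fccStacking 1 (Real.sqrt (2 / 3)), g p ∈ fccStacking 1 (Real.sqrt (2 / 3))) ∧
        (∀ p ∈ fccStacking 1 (Real.sqrt (2 / 3)), g.symm p ∈ fccStacking 1 (Real.sqrt (2 / 3)))) ∧
      0 ≤ A (g x) ∧ A (g x) ≤ B (g x) ∧ B (g x) ≤ C (g x) := by
  obtain ⟨⟨huΛ, hun⟩, ⟨hvΛ, hvn⟩, ⟨htΛ, htn⟩, ⟨huvΛ, huvn⟩, ⟨hutΛ, hutn⟩, ⟨hvtΛ, hvtn⟩⟩ :=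
    bond_mem_and_norm
  have Gu := latticeIsometry_bondReflection huΛ hun
  have Gv := latticeIsometry_bondReflection hvΛ hvn
  have Gt := latticeIsometry_bondReflection htΛ htn
  have Guv := latticeIsometry_bondReflection huvΛ huvn
  have Gut := latticeIsometry_bondReflection hutΛ hutn
  have Gvt := latticeIsometry_bondReflection hvtΛ hvtn
  -- step 1: signs
  have step1 : ∀ y : EuclideanSpace ℝ (Fin 3), ∃ g : EuclideanSpace ℝ (Fin 3) ≃ₗᵢ[ℝ] EuclideanSpace ℝ (Fin 3),
      ((∀ p ∈ fccStacking 1 (Real.sqrt (2 / 3)), g p ∈ fccStacking 1 (Real.sqrt (2 / 3))) ∧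
        (∀ p ∈ fccStacking 1 (Real.sqrt (2 / 3)), g.symm p ∈ fccStacking 1 (Real.sqrt (2 / 3)))) ∧
      0 ≤ A (g y) ∧ 0 ≤ B (g y) ∧ 0 ≤ C (g y) := by
    intro y
    obtain ⟨⟨u1, u2, u3⟩, ⟨v1, v2, v3⟩, ⟨t1, t2, t3⟩, -, -, -, -⟩ := cubic_actions A B C hA hB hC y
    have hneg := fun w => (cubic_actions A B C hA hB hC w).2.2.2.2.2.2
    rcases le_or_gt 0 (A y) with ha | ha <;> rcases le_or_gt 0 (B y) with hb | hb <;>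
      rcases le_or_gt 0 (C y) with hc | hc
    · exact ⟨_, latticeIsometry_refl, ha, hb, hc⟩
    · refine ⟨(((ℝ ∙ barlowPos 1 (Real.sqrt (2 / 3)) constHagg 0 1 0)ᗮ).reflection).trans
        (LinearIsometryEquiv.neg ℝ), latticeIsometry_trans Gu latticeIsometry_neg, ?_⟩
      obtain ⟨f1, f2, f3⟩ := hneg ((ℝ ∙ barlowPos 1 (Real.sqrt (2 / 3)) constHagg 0 1 0)ᗮ.reflection y)
      rw [LinearIsometryEquiv.trans_apply, f1, f2, f3, u1, u2, u3]
      exact ⟨by linarith, by linarith, by linarith⟩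
    · refine ⟨(((ℝ ∙ barlowPos 1 (Real.sqrt (2 / 3)) constHagg 0 0 1)ᗮ).reflection).trans
        (LinearIsometryEquiv.neg ℝ), latticeIsometry_trans Gv latticeIsometry_neg, ?_⟩
      obtain ⟨f1, f2, f3⟩ := hneg ((ℝ ∙ barlowPos 1 (Real.sqrt (2 / 3)) constHagg 0 0 1)ᗮ.reflection y)
      rw [LinearIsometryEquiv.trans_apply, f1, f2, f3, v1, v2, v3]
      exact ⟨by linarith, by linarith, by linarith⟩
    · refine ⟨(ℝ ∙ barlowPos 1 (Real.sqrt (2 / 3)) constHagg 1 0 0)ᗮ.reflection, Gt, ?_⟩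
      rw [t1, t2, t3]
      exact ⟨by linarith, by linarith, by linarith⟩
    · refine ⟨(((ℝ ∙ barlowPos 1 (Real.sqrt (2 / 3)) constHagg 1 0 0)ᗮ).reflection).trans
        (LinearIsometryEquiv.neg ℝ), latticeIsometry_trans Gt latticeIsometry_neg, ?_⟩
      obtain ⟨f1, f2, f3⟩ := hneg ((ℝ ∙ barlowPos 1 (Real.sqrt (2 / 3)) constHagg 1 0 0)ᗮ.reflection y)
      rw [LinearIsometryEquiv.trans_apply, f1, f2, f3, t1, t2, t3]
      exact ⟨by linarith, by linarith, by linarith⟩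
    · refine ⟨(ℝ ∙ barlowPos 1 (Real.sqrt (2 / 3)) constHagg 0 0 1)ᗮ.reflection, Gv, ?_⟩
      rw [v1, v2, v3]
      exact ⟨by linarith, by linarith, by linarith⟩
    · refine ⟨(ℝ ∙ barlowPos 1 (Real.sqrt (2 / 3)) constHagg 0 1 0)ᗮ.reflection, Gu, ?_⟩
      rw [u1, u2, u3]
      exact ⟨by linarith, by linarith, by linarith⟩
    · refine ⟨LinearIsometryEquiv.neg ℝ, latticeIsometry_neg, ?_⟩
      obtain ⟨f1, f2, f3⟩ := hneg y
      rw [f1, f2, f3]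
      exact ⟨by linarith, by linarith, by linarith⟩
  -- step 2: sorting
  have step2 : ∀ y : EuclideanSpace ℝ (Fin 3), 0 ≤ A y → 0 ≤ B y → 0 ≤ C y →
      ∃ g : EuclideanSpace ℝ (Fin 3) ≃ₗᵢ[ℝ] EuclideanSpace ℝ (Fin 3),
      ((∀ p ∈ fccStacking 1 (Real.sqrt (2 / 3)), g p ∈ fccStacking 1 (Real.sqrt (2 / 3))) ∧
        (∀ p ∈ fccStacking 1 (Real.sqrt (2 / 3)), g.symm p ∈ fccStacking 1 (Real.sqrt (2 / 3)))) ∧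
      0 ≤ A (g y) ∧ A (g y) ≤ B (g y) ∧ B (g y) ≤ C (g y) := by
    intro y ha hb hc
    obtain ⟨-, -, -, ⟨p1, p2, p3⟩, ⟨q1, q2, q3⟩, ⟨r1, r2, r3⟩, -⟩ := cubic_actions A B C hA hB hC y
    have huv := fun w => (cubic_actions A B C hA hB hC w).2.2.2.1
    have hvt := fun w => (cubic_actions A B C hA hB hC w).2.2.2.2.2.1
    rcases le_total (A y) (B y) with hab | hab <;> rcases le_total (B y) (C y) with hbc | hbc
    · exact ⟨_, latticeIsometry_refl, ha, hab, hbc⟩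
    · rcases le_total (A y) (C y) with hac | hac
      · refine ⟨(ℝ ∙ (barlowPos 1 (Real.sqrt (2 / 3)) constHagg 0 1 0 -
          barlowPos 1 (Real.sqrt (2 / 3)) constHagg 0 0 1))ᗮ.reflection, Guv, ?_⟩
        rw [p1, p2, p3]; exact ⟨ha, hac, hbc⟩
      · refine ⟨((ℝ ∙ (barlowPos 1 (Real.sqrt (2 / 3)) constHagg 0 1 0 -
            barlowPos 1 (Real.sqrt (2 / 3)) constHagg 0 0 1))ᗮ.reflection).trans
          ((ℝ ∙ (barlowPos 1 (Real.sqrt (2 / 3)) constHagg 0 0 1 -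
            barlowPos 1 (Real.sqrt (2 / 3)) constHagg 1 0 0))ᗮ.reflection),
          latticeIsometry_trans Guv Gvt, ?_⟩
        obtain ⟨f1, f2, f3⟩ := hvt ((ℝ ∙ (barlowPos 1 (Real.sqrt (2 / 3)) constHagg 0 1 0 -
            barlowPos 1 (Real.sqrt (2 / 3)) constHagg 0 0 1))ᗮ.reflection y)
        rw [LinearIsometryEquiv.trans_apply, f1, f2, f3, p1, p2, p3]
        exact ⟨hc, hac, hab⟩
    · rcases le_total (A y) (C y) with hac | hac
      · refine ⟨(ℝ ∙ (barlowPos 1 (Real.sqrt (2 / 3)) constHagg 0 0 1 -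
          barlowPos 1 (Real.sqrt (2 / 3)) constHagg 1 0 0))ᗮ.reflection, Gvt, ?_⟩
        rw [r1, r2, r3]; exact ⟨hb, hab, hac⟩
      · refine ⟨((ℝ ∙ (barlowPos 1 (Real.sqrt (2 / 3)) constHagg 0 0 1 -
            barlowPos 1 (Real.sqrt (2 / 3)) constHagg 1 0 0))ᗮ.reflection).trans
          ((ℝ ∙ (barlowPos 1 (Real.sqrt (2 / 3)) constHagg 0 1 0 -
            barlowPos 1 (Real.sqrt (2 / 3)) constHagg 0 0 1))ᗮ.reflection),
          latticeIsometry_trans Gvt Guv, ?_⟩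
        obtain ⟨f1, f2, f3⟩ := huv ((ℝ ∙ (barlowPos 1 (Real.sqrt (2 / 3)) constHagg 0 0 1 -
            barlowPos 1 (Real.sqrt (2 / 3)) constHagg 1 0 0))ᗮ.reflection y)
        rw [LinearIsometryEquiv.trans_apply, f1, f2, f3, r1, r2, r3]
        exact ⟨hb, hbc, hac⟩
    · refine ⟨(ℝ ∙ (barlowPos 1 (Real.sqrt (2 / 3)) constHagg 0 1 0 -
        barlowPos 1 (Real.sqrt (2 / 3)) constHagg 1 0 0))ᗮ.reflection, Gut, ?_⟩
      rw [q1, q2, q3]; exact ⟨hc, hbc, hab⟩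
  obtain ⟨g₁, hG₁, ha, hb, hc⟩ := step1 x
  obtain ⟨g₂, hG₂, h1, h2, h3⟩ := step2 (g₁ x) ha hb hc
  exact ⟨g₁.trans g₂, latticeIsometry_trans hG₁ hG₂, h1, h2, h3⟩

end Summit.Ventures.Crystal3D.Theorems

end
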